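import Literature.NumberTheory.GaloisRepresentations.PairingAnnihilatorOfInf
import HarnessLib

/-!
# Exact annihilators from isotropy and counting, for a pairing of two finite groups that is perfect after a
# character of the value group (the finishing step of «`F` is its own exact orthogonal complement», H.4)

Topic `NumberTheory/GaloisRepresentations` (next to `PairingAnnihilatorOfInf`, `LocalGlobalCohomologyDualityProofs`).
THEOREMS ONLY (no definition, no named fact, no instance, no `sorry`). Annihilators are written as the terms
`⨅ t ∈ T, (b.flip t).ker` (left annihilator of `T ≤ Y` in `X`) and `⨅ s ∈ S, (b s).ker` (right annihilator of
`S ≤ X` in `Y`), as in `PairingAnnihilatorOfInf`.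

Howard 2004, H.4 asks that a local condition `F_v ⊂ H¹(K_v, T)` be «its own exact orthogonal complement» under the
induced local pairing `H¹(K_v, T) × H¹(K_{v̄}, T) → R` (the cell's typed `DualityDatum.IsSelfOrthogonalAt`: two `↔`
clauses). In practice one proves ISOTROPY `⟨F_v, F_{v̄}⟩ = 0` and a COUNT `#F_v · #F_{v̄} = #H¹(K_v, T)` (local Tate
duality / Euler characteristic), and the exactness of both annihilators is then formal — provided the pairing is
perfect. This file is that formal step, for a bi-additive pairing `b : X × Y → ℤ/n` of two finite `n`-torsion
groups with injective adjoints on both sides (§1–§2), and for a pairing `c : X × Y → Q` into ANY group that becomes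
such a `b` after a character `ω : Q → ℤ/n` (§3 — the case of an `R(1)`-valued cup product read through the tree's
Frobenius/tail form `λ`, cell files `IwasawaAlgebraEisensteinQuotient{Duality,Reciprocity}`):

* `natCard_eq_of_injective_pairing` (`#X = #Y`), `natCard_iInf_ker_flip_mul_natCard₂` (`#T^⊥ · #T = #X`),
  `natCard_iInf_ker_mul_natCard₂` (`#S^⊥ · #S = #Y`);
* **`mem_iff_forall_of_isotropic_of_card`**: `S ⊥ T` and `#S · #T = #X` ⇒ `S = T^⊥` and `T = S^⊥` (both `↔` clauses);
* **`mem_iff_forall_of_isotropic_of_card_comp`**: the same conclusions for `c` when `b = ω ∘ c`.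

References: [MilneADT2006] J. S. Milne, *Arithmetic Duality Theorems*, I §0 (Prop. 0.19: duality of finite groups),
I Cor. 2.3 / Thm. 2.6 (local conditions as exact annihilators); [Howard2004HeegnerKolyvagin] §1.3, H.4.
BSD is not proved by any of this.
-/

noncomputable section

open Function

namespace Literature.NumberTheory.GaloisRepresentations

section TwoGroups

variable {X Y : Type*} [AddCommGroup X] [AddCommGroup Y] [Finite X] [Finite Y] {n : ℕ} [NeZero n]
  (b : X →+ Y →+ ZMod n) (hX : ∀ x : X, n • x = 0) (hY : ∀ y : Y, n • y = 0)
  (hinjL : Injective b) (hinjR : Injective b.flip)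

omit [Finite X] [Finite Y] [NeZero n] in
/-- Membership in the left annihilator `T^⊥ = ⨅ t ∈ T, ker b(·, t)`. [cite: MilneADT2006, Ch. I §0, Prop. 0.19] -/
theorem mem_iInf_ker_flip_iff₂ (T : AddSubgroup Y) (x : X) :
    x ∈ (⨅ t ∈ T, (b.flip t).ker : AddSubgroup X) ↔ ∀ t ∈ T, b x t = 0 := by
  simp only [AddSubgroup.mem_iInf, AddMonoidHom.mem_ker, AddMonoidHom.flip_apply]

omit [Finite X] [Finite Y] [NeZero n] in
/-- Membership in the right annihilator `S^⊥ = ⨅ s ∈ S, ker b(s, ·)`. [cite: MilneADT2006, Ch. I §0, Prop. 0.19] -/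
theorem mem_iInf_ker_iff₂ (S : AddSubgroup X) (y : Y) :
    y ∈ (⨅ s ∈ S, (b s).ker : AddSubgroup Y) ↔ ∀ s ∈ S, b s y = 0 := by
  simp only [AddSubgroup.mem_iInf, AddMonoidHom.mem_ker]

omit [Finite X] in
include hY hinjL in
/-- `#X ≤ #Y` when `x ↦ b(x, ·)` is injective (`X ↪ Hom(Y, ℤ/n)`, `#Hom(Y, ℤ/n) = #Y`). [cite: MilneADT2006, Ch. I §0, Prop. 0.19] -/
theorem natCard_le_of_injective_left : Nat.card X ≤ Nat.card Y := by
  haveI := finite_addMonoidHom_zmod Y n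
  calc Nat.card X ≤ Nat.card (Y →+ ZMod n) := Nat.card_le_card_of_injective _ hinjL
    _ = Nat.card Y := Nat.card_addMonoidHom_zmod hY

include hX hY hinjL hinjR in
/-- **`#X = #Y`** for a pairing of finite `n`-torsion groups with injective adjoints on both sides.
[cite: MilneADT2006, Ch. I §0, Prop. 0.19] -/
theorem natCard_eq_of_injective_pairing : Nat.card X = Nat.card Y :=
  le_antisymm (natCard_le_of_injective_left b hY hinjL) (natCard_le_of_injective_left b.flip hX hinjR)

include hX hY hinjL hinjR in
/-- **`#T^⊥ · #T = #X`** for every subgroup `T ≤ Y` (`T^⊥ ↪ Hom(Y/T, ℤ/n)` by injectivity; `X/T^⊥ ↪ Hom(T, ℤ/n)` by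
restriction; `#Hom(B, ℤ/n) = #B`; `#X = #Y`). [cite: MilneADT2006, Ch. I §0, Prop. 0.19] -/
theorem natCard_iInf_ker_flip_mul_natCard₂ (T : AddSubgroup Y) :
    Nat.card (⨅ t ∈ T, (b.flip t).ker : AddSubgroup X) * Nat.card T = Nat.card X := by
  have hXY := natCard_eq_of_injective_pairing b hX hY hinjL hinjR
  apply le_antisymm
  · -- `T^⊥ ↪ Hom(Y ⧸ T, ℤ/n)`
    have hq : ∀ z : Y ⧸ T, n • z = 0 := fun z => by
      induction z using QuotientAddGroup.induction_on with
      | H y => rw [← QuotientAddGroup.mk_nsmul, hY, QuotientAddGroup.mk_zero]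
    haveI := finite_addMonoidHom_zmod (Y ⧸ T) n
    let φ : (⨅ t ∈ T, (b.flip t).ker : AddSubgroup X) → (Y ⧸ T →+ ZMod n) := fun x =>
      QuotientAddGroup.lift T (b x) fun y hy =>
        (AddMonoidHom.mem_ker).mpr (((mem_iInf_ker_flip_iff₂ b T x).mp x.2) y hy)
    have hφ : Injective φ := by
      intro x x' h
      apply Subtype.ext
      apply hinjL
      refine AddMonoidHom.ext fun y => ?_
      have h' := DFunLike.congr_fun h (y : Y ⧸ T)
      rwa [QuotientAddGroup.lift_mk, QuotientAddGroup.lift_mk] at h'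
    calc Nat.card (⨅ t ∈ T, (b.flip t).ker : AddSubgroup X) * Nat.card T
        ≤ Nat.card (Y ⧸ T →+ ZMod n) * Nat.card T := Nat.mul_le_mul_right _ (Nat.card_le_card_of_injective φ hφ)
      _ = Nat.card (Y ⧸ T) * Nat.card T := by rw [Nat.card_addMonoidHom_zmod hq]
      _ = Nat.card Y := (AddSubgroup.card_eq_card_quotient_mul_card_addSubgroup T).symm
      _ = Nat.card X := hXY.symm
  · -- `X ⧸ T^⊥ ↪ Hom(T, ℤ/n)` by restriction
    haveI := finite_addMonoidHom_zmod T n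
    let r : X →+ (T →+ ZMod n) :=
      AddMonoidHom.mk' (fun x => (b x).comp T.subtype) fun x x' => by
        ext t
        simp only [map_add, AddMonoidHom.coe_comp, comp_apply, AddMonoidHom.add_apply]
    have hr : ∀ (x : X) (t : T), r x t = b x t := fun _ _ => rfl
    have hker : r.ker = ⨅ t ∈ T, (b.flip t).ker := by
      ext x
      rw [AddMonoidHom.mem_ker, mem_iInf_ker_flip_iff₂]
      constructor
      · intro h t ht
        rw [← hr x ⟨t, ht⟩, h, AddMonoidHom.zero_apply]
      · intro h
        exact AddMonoidHom.ext fun t => (hr x t).trans (h t t.2)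
    have hT : ∀ t : T, n • t = 0 := fun t => Subtype.ext (by
      rw [AddSubgroupClass.coe_nsmul, hY]; rfl)
    calc Nat.card X = Nat.card (X ⧸ r.ker) * Nat.card r.ker :=
          AddSubgroup.card_eq_card_quotient_mul_card_addSubgroup r.ker
      _ ≤ Nat.card (T →+ ZMod n) * Nat.card r.ker :=
          Nat.mul_le_mul_right _ (Nat.card_le_card_of_injective _ (QuotientAddGroup.kerLift_injective r))
      _ = Nat.card T * Nat.card (⨅ t ∈ T, (b.flip t).ker : AddSubgroup X) := by
          rw [Nat.card_addMonoidHom_zmod hT, hker]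
      _ = Nat.card (⨅ t ∈ T, (b.flip t).ker : AddSubgroup X) * Nat.card T := mul_comm _ _

include hX hY hinjL hinjR in
/-- **`#S^⊥ · #S = #Y`** for every subgroup `S ≤ X` (the previous statement for the flipped pairing).
[cite: MilneADT2006, Ch. I §0, Prop. 0.19] -/
theorem natCard_iInf_ker_mul_natCard₂ (S : AddSubgroup X) :
    Nat.card (⨅ s ∈ S, (b s).ker : AddSubgroup Y) * Nat.card S = Nat.card Y := by
  have hflip : b.flip.flip = b := AddMonoidHom.ext fun _ => AddMonoidHom.ext fun _ => rfl
  have h := natCard_iInf_ker_flip_mul_natCard₂ b.flip hY hX hinjR (by rw [hflip]; exact hinjL) S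
  rw [hflip] at h
  exact h

include hX hY hinjL hinjR in
/-- **Exact annihilators from isotropy and counting.** If `S ≤ X` and `T ≤ Y` are ISOTROPIC (`b(S, T) = 0`) and
`#S · #T = #X`, then `S` is exactly the left annihilator of `T` and `T` exactly the right annihilator of `S` —
both clauses of «`F` is its own exact orthogonal complement» (H.4). [cite: MilneADT2006, Ch. I §0, Prop. 0.19]
[cite: Howard2004HeegnerKolyvagin, §1.3 (H.4, «its own exact orthogonal complement»)] -/
theorem mem_iff_forall_of_isotropic_of_card (S : AddSubgroup X) (T : AddSubgroup Y)
    (hST : ∀ s ∈ S, ∀ t ∈ T, b s t = 0) (hcard : Nat.card S * Nat.card T = Nat.card X) :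
    (∀ x : X, x ∈ S ↔ ∀ t ∈ T, b x t = 0) ∧ (∀ y : Y, y ∈ T ↔ ∀ s ∈ S, b s y = 0) := by
  have hXY := natCard_eq_of_injective_pairing b hX hY hinjL hinjR
  have hTpos : 0 < Nat.card T := Nat.card_pos
  have hSpos : 0 < Nat.card S := Nat.card_pos
  -- `S = T^⊥`
  have hS : S = ⨅ t ∈ T, (b.flip t).ker := by
    refine AddSubgroup.eq_of_le_of_card_ge (fun s hs => (mem_iInf_ker_flip_iff₂ b T s).mpr (hST s hs)) ?_
    have h := natCard_iInf_ker_flip_mul_natCard₂ b hX hY hinjL hinjR T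
    rw [← hcard] at h
    exact (Nat.eq_of_mul_eq_mul_right hTpos h).le
  -- `T = S^⊥`
  have hT : T = ⨅ s ∈ S, (b s).ker := by
    refine AddSubgroup.eq_of_le_of_card_ge (fun t ht => (mem_iInf_ker_iff₂ b S t).mpr fun s hs => hST s hs t ht) ?_
    have h := natCard_iInf_ker_mul_natCard₂ b hX hY hinjL hinjR S
    rw [← hXY, ← hcard, mul_comm (Nat.card S)] at h
    exact (Nat.eq_of_mul_eq_mul_right hSpos h).le
  refine ⟨fun x => ?_, fun y => ?_⟩
  · rw [← mem_iInf_ker_flip_iff₂ b T x, ← hS]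
  · rw [← mem_iInf_ker_iff₂ b S y, ← hT]

end TwoGroups

/-! ## §3 A pairing into any group that is perfect after a character `ω : Q → ℤ/n` -/

section Comp

variable {X Y Q : Type*} [AddCommGroup X] [AddCommGroup Y] [AddCommGroup Q] [Finite X] [Finite Y] {n : ℕ} [NeZero n]
  (c : X →+ Y →+ Q) (ω : Q →+ ZMod n) (hX : ∀ x : X, n • x = 0) (hY : ∀ y : Y, n • y = 0)
  (hinjL : Injective (c.compr₂ ω)) (hinjR : Injective (c.compr₂ ω).flip)

include hX hY hinjL hinjR in
/-- **Exact annihilators for `c : X × Y → Q` from isotropy and counting**, when `ω ∘ c` (`ω : Q → ℤ/n` a character of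
the value group — e.g. an `R(1)`-valued local cup product read through the Frobenius form of `R` and the invariant
map) has injective adjoints on both sides: `c(S, T) = 0` and `#S · #T = #X` imply that `S` and `T` are EXACT
annihilators of each other under `c` itself (`S ⊆ T^{⊥_c} ⊆ T^{⊥_{ω∘c}} = S`). This is the formal last step of
«`F_v` is its own exact orthogonal complement under the induced local pairing» (Howard H.4 / the cell's
`DualityDatum.IsSelfOrthogonalAt`) once isotropy and the local count are known. [cite: Howard2004HeegnerKolyvagin, §1.3 (H.4)]
[cite: MilneADT2006, Ch. I §0, Prop. 0.19] -/
theorem mem_iff_forall_of_isotropic_of_card_comp (S : AddSubgroup X) (T : AddSubgroup Y)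
    (hST : ∀ s ∈ S, ∀ t ∈ T, c s t = 0) (hcard : Nat.card S * Nat.card T = Nat.card X) :
    (∀ x : X, x ∈ S ↔ ∀ t ∈ T, c x t = 0) ∧ (∀ y : Y, y ∈ T ↔ ∀ s ∈ S, c s y = 0) := by
  have hb : ∀ (x : X) (y : Y), (c.compr₂ ω) x y = ω (c x y) := fun _ _ => rfl
  obtain ⟨h1, h2⟩ := mem_iff_forall_of_isotropic_of_card (c.compr₂ ω) hX hY hinjL hinjR S T
    (fun s hs t ht => by rw [hb, hST s hs t ht, map_zero]) hcard
  refine ⟨fun x => ⟨fun hx t ht => ?_, fun h => (h1 x).mpr fun t ht => by rw [hb, h t ht, map_zero]⟩,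
    fun y => ⟨fun hy s hs => hST s hs y hy, fun h => (h2 y).mpr fun s hs => by rw [hb, h s hs, map_zero]⟩⟩
  exact hST x hx t ht

end Comp

end Literature.NumberTheory.GaloisRepresentations
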